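import Summits.ABC.ABC.Theorems.IUTThetaPilotAbcOfPilotKummer
import HarnessLib

/-!
# Route `IUTThetaPilot`, crux `ThetaPartII` (stmt-ABC-19678): the re-based branch-C engine with the Θ-side reading in its
# FINITENESS-NEUTRAL form `hΘle : ∀ x, Pc.negLogTheta = ↑x → x ≤ T.negLogTheta`

Companion (proof-only, composition BY NAME) of `IUTThetaPilotAbcOfPilotKummer.lean` (abc-iut-w4-d001 g3; p429014/p429391/p429879).
There the Θ-side READ binder is `hΘ : Pc.negLogTheta ≤ ↑T.negLogTheta` in `WithTop ℝ`, which silently entails `Pc.negLogTheta ≠ ⊤`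
(i.e. [IUTchIII] Cor. 3.12's FIRST clause "−|log(Θ)| ∈ ℝ", `ThetaFinite`). abc-iut-S3 g4 (HOME/STATUS 2026-08-26T06:59:26Z (1)) and
abc-iut-C-cert-1 (06:57:03Z (a)) asked for the strictly WEAKER, finiteness-neutral reading for branch C's v3:

  `hΘle : ∀ x : ℝ, Pc.negLogTheta = ↑x → x ≤ T.negLogTheta`

("IF the verbatim −|log(Θ)| is a real number, it is at most the datum's defined number") — it asserts nothing about finiteness,
which the derivation obtains from the Statement itself (`Setting.Statement`'s first conjunct, delivered by S + pins + bridge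
hypotheses). This file re-derives the engine's four theorems with `hΘle` in place of `hΘ` (same proofs otherwise; every other
binder verbatim): `cor312Of_datum_of_pilotKummerIndRelated_fin`, `cor312AtDatum_of_pilotKummerIndRelated_fin`,
`vojta_degOne_of_pilotKummerIndRelated_fin` (d = 1 cut, 6 binder families), `abc_of_pilotKummerIndRelated_of_genEllTwo_fin`
(8 binder families incl. the support `GenEllTwo`). CONDITIONAL results (`--supports stmt-ABC-19678`); the crux stays OPEN.
HONEST FRAMING: nothing here asserts abc, S, [IUTchIV] Thm. 1.10 or [IUTchIII] Cor. 3.12, or takes a side on any author; S is an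
assumption label; typed ≠ proved. [claim: Mochizuki2012, status: disputed] for every IUT sentence referred to.
-/

set_option linter.dupNamespace false

noncomputable section

namespace Summit.ABC.ABC.Theorems.ThetaPartII

open Literature.NumberTheory.DiophantineGeometry Literature.NumberTheory.DiophantineGeometry.GenEll
open Literature.IUT.LogVolume Summit.ABC.IUTFork Summit.ABC.IUTFork.Thm311 Summit.ABC.IUTFork.Cor312Vol

/-- **S at one genuine Θ-volume datum gives Cor. 3.12 for that datum's DEFINED numbers — finiteness-neutral Θ-reading.** As
`cor312Of_datum_of_pilotKummerIndRelated`, with `hΘle : ∀ x, Pc.negLogTheta = ↑x → x ≤ T.negLogTheta` in place of `hΘ`; the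
finiteness `Pc.negLogTheta ≠ ⊤` is the first conjunct of the Statement obtained from S + pins + bridge hypotheses + (ii)(b)
(abc-iut-w5-d230's `statement_of_pinned3_of_pilotKummerIndRelated`), then abc-iut-c312-8's `Cor312Prov.cor312Of_of_statement_of_links`.
CONDITIONAL; asserts nothing. [cite: Mochizuki2012, IUTchIII Cor. 3.12 p.173–174] [claim: Mochizuki2012, status: disputed] -/
theorem cor312Of_datum_of_pilotKummerIndRelated_fin {P : NFPoint} {l : ℕ} (T : Cor22.ThetaVolumeDatumAt P l)
    {TI : ThetaIndex} (St : LatticeSituation TI) (Pc : Cor312.Setting St.toSituation)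
    (ρ : (∀ v : TI.V, v ∈ TI.Vbad → Set (St.L.StarPacket v)) → ∀ (j : TI.Label) (vQ : TI.VQ), Set (St.L.Packet j vQ))
    (qK : ∀ v : TI.V, v ∈ TI.Vbad → Set (St.L.StarPacket v))
    (hSet : letI := T.instFieldF; letI := T.instNumberFieldF; letI := T.instAlgebraF; letI := T.instFieldK
      letI := T.instNumberFieldK; letI := T.instAlgebraK; letI := T.instFieldFbar; letI := T.instAlgebraFbar
      letI := T.instAlgebraKFbar; letI := T.instIsElliptic
      Cor312Prov.IsSettingOf T.D Pc)
    (hBridge : BridgeHyps Pc) (hKumB : (St.col Pc.n).KummerB (St.D Pc.n))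
    (hPin : PinnedRegions3 St Pc ρ qK) (hS : PilotKummerIndRelated St Pc ρ qK)
    (hΘle : ∀ x : ℝ, Pc.negLogTheta = (x : WithTop ℝ) → x ≤ T.negLogTheta) : T.Cor312Of := by
  letI := T.instFieldF; letI := T.instNumberFieldF; letI := T.instAlgebraF; letI := T.instFieldK
  letI := T.instNumberFieldK; letI := T.instAlgebraK; letI := T.instFieldFbar; letI := T.instAlgebraFbar
  letI := T.instAlgebraKFbar; letI := T.instIsElliptic
  have hst : Pc.Statement := statement_of_pinned3_of_pilotKummerIndRelated St Pc ρ qK hBridge hKumB hPin hS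
  obtain ⟨x, hx⟩ := WithTop.ne_top_iff_exists.mp hst.1
  have hΘ : Pc.negLogTheta ≤ ((T.negLogTheta : ℝ) : WithTop ℝ) := by
    rw [← hx]
    exact WithTop.coe_le_coe.mpr (hΘle x hx.symm)
  exact Cor312Prov.cor312Of_of_statement_of_links T.D T.isVolumeInputOf hSet hΘ hst

/-- **`Cor22.Cor312AtDatum P l` from S at every datum of `(P, l)` — finiteness-neutral Θ-reading** (twin of
`cor312AtDatum_of_pilotKummerIndRelated` with `hΘle`). CONDITIONAL; asserts nothing.
[cite: Mochizuki2012, IUTchIII Cor. 3.12 p.173–174] [claim: Mochizuki2012, status: disputed] -/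
theorem cor312AtDatum_of_pilotKummerIndRelated_fin {P : NFPoint} {l : ℕ}
    (TI : Cor22.ThetaVolumeDatumAt P l → ThetaIndex)
    (St : ∀ T : Cor22.ThetaVolumeDatumAt P l, LatticeSituation (TI T))
    (Pc : ∀ T : Cor22.ThetaVolumeDatumAt P l, Cor312.Setting (St T).toSituation)
    (ρ : ∀ T : Cor22.ThetaVolumeDatumAt P l,
      (∀ v : (TI T).V, v ∈ (TI T).Vbad → Set ((St T).L.StarPacket v)) →
        ∀ (j : (TI T).Label) (vQ : (TI T).VQ), Set ((St T).L.Packet j vQ))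
    (qK : ∀ T : Cor22.ThetaVolumeDatumAt P l, ∀ v : (TI T).V, v ∈ (TI T).Vbad → Set ((St T).L.StarPacket v))
    (hSet : ∀ T : Cor22.ThetaVolumeDatumAt P l,
      letI := T.instFieldF; letI := T.instNumberFieldF; letI := T.instAlgebraF; letI := T.instFieldK
      letI := T.instNumberFieldK; letI := T.instAlgebraK; letI := T.instFieldFbar; letI := T.instAlgebraFbar
      letI := T.instAlgebraKFbar; letI := T.instIsElliptic
      Cor312Prov.IsSettingOf T.D (Pc T))
    (hBridge : ∀ T, BridgeHyps (Pc T)) (hKumB : ∀ T, ((St T).col (Pc T).n).KummerB ((St T).D (Pc T).n))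
    (hPin : ∀ T, PinnedRegions3 (St T) (Pc T) (ρ T) (qK T))
    (hS : ∀ T, PilotKummerIndRelated (St T) (Pc T) (ρ T) (qK T))
    (hΘle : ∀ (T : Cor22.ThetaVolumeDatumAt P l) (x : ℝ), (Pc T).negLogTheta = (x : WithTop ℝ) → x ≤ T.negLogTheta) :
    Cor22.Cor312AtDatum P l := fun T =>
  cor312Of_datum_of_pilotKummerIndRelated_fin T (St T) (Pc T) (ρ T) (qK T) (hSet T) (hBridge T) (hKumB T) (hPin T)
    (hS T) (hΘle T)

/-- **The d = 1 cut, finiteness-neutral Θ-reading**: Vojta's height inequality in degree `1` on every compactly bounded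
`K_V ∋ 2` from S at the Θ-data of the rational points of the `λ`-line (+ setting data, pins, bridge hypotheses, (ii)(b) at
column `n`, `hΘle`) — twin of `vojta_degOne_of_pilotKummerIndRelated`. CONDITIONAL on S; asserts nothing about any curve.
[cite: Mochizuki2012, IUTchIV Cor. 2.2–2.3 pp.41–55] [claim: Mochizuki2012, status: disputed] -/
theorem vojta_degOne_of_pilotKummerIndRelated_fin
    (TI : ∀ {P : NFPoint} {l : ℕ}, Cor22.ThetaVolumeDatumAt P l → ThetaIndex)
    (St : ∀ {P : NFPoint} {l : ℕ} (T : Cor22.ThetaVolumeDatumAt P l), LatticeSituation (TI T))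
    (Pc : ∀ {P : NFPoint} {l : ℕ} (T : Cor22.ThetaVolumeDatumAt P l), Cor312.Setting (St T).toSituation)
    (ρ : ∀ {P : NFPoint} {l : ℕ} (T : Cor22.ThetaVolumeDatumAt P l),
      (∀ v : (TI T).V, v ∈ (TI T).Vbad → Set ((St T).L.StarPacket v)) →
        ∀ (j : (TI T).Label) (vQ : (TI T).VQ), Set ((St T).L.Packet j vQ))
    (qK : ∀ {P : NFPoint} {l : ℕ} (T : Cor22.ThetaVolumeDatumAt P l),
      ∀ v : (TI T).V, v ∈ (TI T).Vbad → Set ((St T).L.StarPacket v))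
    (hSet : ∀ P : NFPoint, P ∈ UP → P.degree ≤ 1 → ∀ l : ℕ, l.Prime → 5 ≤ l →
      Cor22.AdmitsCore P → Cor22.CondP2 P l → Cor22.CondP5 P l → Cor22.CondP6 P l →
      ∀ T : Cor22.ThetaVolumeDatumAt P l,
        letI := T.instFieldF; letI := T.instNumberFieldF; letI := T.instAlgebraF; letI := T.instFieldK
        letI := T.instNumberFieldK; letI := T.instAlgebraK; letI := T.instFieldFbar; letI := T.instAlgebraFbar
        letI := T.instAlgebraKFbar; letI := T.instIsElliptic
        Cor312Prov.IsSettingOf T.D (Pc T))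
    (hBridge : ∀ P : NFPoint, P ∈ UP → P.degree ≤ 1 → ∀ l : ℕ, l.Prime → 5 ≤ l →
      Cor22.AdmitsCore P → Cor22.CondP2 P l → Cor22.CondP5 P l → Cor22.CondP6 P l →
      ∀ T : Cor22.ThetaVolumeDatumAt P l, BridgeHyps (Pc T))
    (hKumB : ∀ P : NFPoint, P ∈ UP → P.degree ≤ 1 → ∀ l : ℕ, l.Prime → 5 ≤ l →
      Cor22.AdmitsCore P → Cor22.CondP2 P l → Cor22.CondP5 P l → Cor22.CondP6 P l →
      ∀ T : Cor22.ThetaVolumeDatumAt P l, ((St T).col (Pc T).n).KummerB ((St T).D (Pc T).n))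
    (hPin : ∀ P : NFPoint, P ∈ UP → P.degree ≤ 1 → ∀ l : ℕ, l.Prime → 5 ≤ l →
      Cor22.AdmitsCore P → Cor22.CondP2 P l → Cor22.CondP5 P l → Cor22.CondP6 P l →
      ∀ T : Cor22.ThetaVolumeDatumAt P l, PinnedRegions3 (St T) (Pc T) (ρ T) (qK T))
    (hS : ∀ P : NFPoint, P ∈ UP → P.degree ≤ 1 → ∀ l : ℕ, l.Prime → 5 ≤ l →
      Cor22.AdmitsCore P → Cor22.CondP2 P l → Cor22.CondP5 P l → Cor22.CondP6 P l →
      ∀ T : Cor22.ThetaVolumeDatumAt P l, PilotKummerIndRelated (St T) (Pc T) (ρ T) (qK T))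
    (hΘle : ∀ P : NFPoint, P ∈ UP → P.degree ≤ 1 → ∀ l : ℕ, l.Prime → 5 ≤ l →
      Cor22.AdmitsCore P → Cor22.CondP2 P l → Cor22.CondP5 P l → Cor22.CondP6 P l →
      ∀ (T : Cor22.ThetaVolumeDatumAt P l) (x : ℝ), (Pc T).negLogTheta = (x : WithTop ℝ) → x ≤ T.negLogTheta)
    {ε : ℝ} (hε : 0 < ε) (D : CBData) (hD : D.SupportContains {2}) : VojtaIneq D.toSet 1 ε :=
  ThetaPartIIDisplay.vojtaIneq_two_degOne_of_cor312
    (fun P hP hdeg l hl h5 hcore h2 hP5 h6 =>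
      cor312AtDatum_of_pilotKummerIndRelated_fin (fun T => TI T) (fun T => St T) (fun T => Pc T) (fun T => ρ T)
        (fun T => qK T) (hSet P hP hdeg l hl h5 hcore h2 hP5 h6) (hBridge P hP hdeg l hl h5 hcore h2 hP5 h6)
        (hKumB P hP hdeg l hl h5 hcore h2 hP5 h6) (hPin P hP hdeg l hl h5 hcore h2 hP5 h6)
        (hS P hP hdeg l hl h5 hcore h2 hP5 h6) (hΘle P hP hdeg l hl h5 hcore h2 hP5 h6))
    hε D hD

/-- **`abc` from S — finiteness-neutral Θ-reading**: twin of `abc_of_pilotKummerIndRelated_of_genEllTwo` with `hΘle : ∀ x,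
(Pc T).negLogTheta = ↑x → x ≤ T.negLogTheta` (strictly weaker than `hΘ`). Binder families: [S] `hS` · [PIN] `hPin`, `hBridge`,
`hSet` · [CONE] `hKumB`, `hvol` · [READ] `hΘle` · [SUPPORT] `hG`. CONDITIONAL; asserts nothing about abc; no side taken.
[cite: Mochizuki2012, IUTchIV Cor. 2.2–2.3 pp.41–55] [claim: Mochizuki2012, status: disputed] -/
theorem abc_of_pilotKummerIndRelated_of_genEllTwo_fin
    (TI : ∀ {P : NFPoint} {l : ℕ}, Cor22.ThetaVolumeDatumAt P l → ThetaIndex)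
    (St : ∀ {P : NFPoint} {l : ℕ} (T : Cor22.ThetaVolumeDatumAt P l), LatticeSituation (TI T))
    (Pc : ∀ {P : NFPoint} {l : ℕ} (T : Cor22.ThetaVolumeDatumAt P l), Cor312.Setting (St T).toSituation)
    (ρ : ∀ {P : NFPoint} {l : ℕ} (T : Cor22.ThetaVolumeDatumAt P l),
      (∀ v : (TI T).V, v ∈ (TI T).Vbad → Set ((St T).L.StarPacket v)) →
        ∀ (j : (TI T).Label) (vQ : (TI T).VQ), Set ((St T).L.Packet j vQ))
    (qK : ∀ {P : NFPoint} {l : ℕ} (T : Cor22.ThetaVolumeDatumAt P l),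
      ∀ v : (TI T).V, v ∈ (TI T).Vbad → Set ((St T).L.StarPacket v))
    (hSet : ∀ P : NFPoint, P ∈ UP → ∀ l : ℕ, l.Prime → 5 ≤ l →
      Cor22.AdmitsCore P → Cor22.CondP2 P l → Cor22.CondP5 P l → Cor22.CondP6 P l →
      ∀ T : Cor22.ThetaVolumeDatumAt P l,
        letI := T.instFieldF; letI := T.instNumberFieldF; letI := T.instAlgebraF; letI := T.instFieldK
        letI := T.instNumberFieldK; letI := T.instAlgebraK; letI := T.instFieldFbar; letI := T.instAlgebraFbar
        letI := T.instAlgebraKFbar; letI := T.instIsElliptic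
        Cor312Prov.IsSettingOf T.D (Pc T))
    (hBridge : ∀ P : NFPoint, P ∈ UP → ∀ l : ℕ, l.Prime → 5 ≤ l →
      Cor22.AdmitsCore P → Cor22.CondP2 P l → Cor22.CondP5 P l → Cor22.CondP6 P l →
      ∀ T : Cor22.ThetaVolumeDatumAt P l, BridgeHyps (Pc T))
    (hKumB : ∀ P : NFPoint, P ∈ UP → ∀ l : ℕ, l.Prime → 5 ≤ l →
      Cor22.AdmitsCore P → Cor22.CondP2 P l → Cor22.CondP5 P l → Cor22.CondP6 P l →
      ∀ T : Cor22.ThetaVolumeDatumAt P l, ((St T).col (Pc T).n).KummerB ((St T).D (Pc T).n))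
    (hPin : ∀ P : NFPoint, P ∈ UP → ∀ l : ℕ, l.Prime → 5 ≤ l →
      Cor22.AdmitsCore P → Cor22.CondP2 P l → Cor22.CondP5 P l → Cor22.CondP6 P l →
      ∀ T : Cor22.ThetaVolumeDatumAt P l, PinnedRegions3 (St T) (Pc T) (ρ T) (qK T))
    (hS : ∀ P : NFPoint, P ∈ UP → ∀ l : ℕ, l.Prime → 5 ≤ l →
      Cor22.AdmitsCore P → Cor22.CondP2 P l → Cor22.CondP5 P l → Cor22.CondP6 P l →
      ∀ T : Cor22.ThetaVolumeDatumAt P l, PilotKummerIndRelated (St T) (Pc T) (ρ T) (qK T))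
    (hΘle : ∀ P : NFPoint, P ∈ UP → ∀ l : ℕ, l.Prime → 5 ≤ l →
      Cor22.AdmitsCore P → Cor22.CondP2 P l → Cor22.CondP5 P l → Cor22.CondP6 P l →
      ∀ (T : Cor22.ThetaVolumeDatumAt P l) (x : ℝ), (Pc T).negLogTheta = (x : WithTop ℝ) → x ≤ T.negLogTheta)
    (hvol : ∀ P : NFPoint, P ∈ UP → ∀ l : ℕ, l.Prime → 5 ≤ l →
      Cor22.AdmitsCore P → Cor22.CondP2 P l → Cor22.CondP5 P l → Cor22.CondP6 P l →
        Cor22.HullVolumeAtDatum P l (((l : ℝ) + 1) / 4 *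
          ((1 + 12 * (Cor22.dmod P : ℝ) / l) * (P.logDiff + Cor22.logCondAvoid P {2, l})
            + 2 * Real.log l + 52
            + 20 / 3 * Real.log (((2 ^ 12 * 3 ^ 3 * 5 * Cor22.dmod P : ℕ) : ℝ) * (l : ℝ))
              * (Nat.primeCounting (2 ^ 12 * 3 ^ 3 * 5 * Cor22.dmod P * l) : ℝ))))
    (hG : Summit.ABC.ABC.Theses.IUTThetaPilot.GenEllTwo) : _root_.ABC :=
  ABC_of_cor312_of_hullVolume_of_genEllTwo
    (fun P hP l hl h5 hcore h2 hP5 h6 =>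
      cor312AtDatum_of_pilotKummerIndRelated_fin (fun T => TI T) (fun T => St T) (fun T => Pc T) (fun T => ρ T)
        (fun T => qK T) (hSet P hP l hl h5 hcore h2 hP5 h6) (hBridge P hP l hl h5 hcore h2 hP5 h6)
        (hKumB P hP l hl h5 hcore h2 hP5 h6) (hPin P hP l hl h5 hcore h2 hP5 h6) (hS P hP l hl h5 hcore h2 hP5 h6)
        (hΘle P hP l hl h5 hcore h2 hP5 h6))
    hvol hG

/-! ## 2. The S-route's ONE named disputed input, `Cor22.Thm110Legendre`, from S (appended) -/

/-- **[IUTchIV] Thm. 1.10 for the Legendre family — the campaign-S route's single named disputed input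
`Literature.IUT.LogVolume.Cor22.Thm110Legendre` (abc-iut-S-d2, `Corollary22Legendre.lean`; consumed by
`ThetaPartII_of_thm110Legendre` / `ABC_of_thm110Legendre_of_genEllTwo`) — FROM THE RESIDUAL S** at the Θ-data of every admissible
`(P, l)` (+ setting data, pins, bridge hypotheses, Thm. 3.11 (ii)(b) at column `n`, the finiteness-neutral Θ-reading `hΘle`) + the
computable half (ii′) `hvol`: at each `(P, l)` a genuine datum exists (`ThetaPartII.stub_thetaData`, abc-iut-L5-t7), S gives
`Cor22.Cor312AtDatum P l` (`cor312AtDatum_of_pilotKummerIndRelated_fin`), the squeeze `((l+1)/24 − 1/(2l))·log(q^{∤{2,l}}) ≤ B_III + ((l+5)/4)·log π`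
follows (abc-iut-S2's `PointDict.logQAvoid_le_of_cor312AtDatum`), and abc-iut-S-d2/S3's `ThetaPartIIDisplay.thm110Legendre_of_squeezeIII`
turns it into the display of Thm. 1.10. So the S-route's disputed NAMED FACT is itself «S + pins + (ii)(b) + (ii′) + hΘle» in the
kernel. CONDITIONAL; asserts nothing about Thm. 1.10; no side taken. [cite: Mochizuki2012, IUTchIV Thm. 1.10 pp.22–31]
[claim: Mochizuki2012, status: disputed] -/
theorem thm110Legendre_of_pilotKummerIndRelated_fin
    (TI : ∀ {P : NFPoint} {l : ℕ}, Cor22.ThetaVolumeDatumAt P l → ThetaIndex)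
    (St : ∀ {P : NFPoint} {l : ℕ} (T : Cor22.ThetaVolumeDatumAt P l), LatticeSituation (TI T))
    (Pc : ∀ {P : NFPoint} {l : ℕ} (T : Cor22.ThetaVolumeDatumAt P l), Cor312.Setting (St T).toSituation)
    (ρ : ∀ {P : NFPoint} {l : ℕ} (T : Cor22.ThetaVolumeDatumAt P l),
      (∀ v : (TI T).V, v ∈ (TI T).Vbad → Set ((St T).L.StarPacket v)) →
        ∀ (j : (TI T).Label) (vQ : (TI T).VQ), Set ((St T).L.Packet j vQ))
    (qK : ∀ {P : NFPoint} {l : ℕ} (T : Cor22.ThetaVolumeDatumAt P l),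
      ∀ v : (TI T).V, v ∈ (TI T).Vbad → Set ((St T).L.StarPacket v))
    (hSet : ∀ P : NFPoint, P ∈ UP → ∀ l : ℕ, l.Prime → 5 ≤ l →
      Cor22.AdmitsCore P → Cor22.CondP2 P l → Cor22.CondP5 P l → Cor22.CondP6 P l →
      ∀ T : Cor22.ThetaVolumeDatumAt P l,
        letI := T.instFieldF; letI := T.instNumberFieldF; letI := T.instAlgebraF; letI := T.instFieldK
        letI := T.instNumberFieldK; letI := T.instAlgebraK; letI := T.instFieldFbar; letI := T.instAlgebraFbar
        letI := T.instAlgebraKFbar; letI := T.instIsElliptic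
        Cor312Prov.IsSettingOf T.D (Pc T))
    (hBridge : ∀ P : NFPoint, P ∈ UP → ∀ l : ℕ, l.Prime → 5 ≤ l →
      Cor22.AdmitsCore P → Cor22.CondP2 P l → Cor22.CondP5 P l → Cor22.CondP6 P l →
      ∀ T : Cor22.ThetaVolumeDatumAt P l, BridgeHyps (Pc T))
    (hKumB : ∀ P : NFPoint, P ∈ UP → ∀ l : ℕ, l.Prime → 5 ≤ l →
      Cor22.AdmitsCore P → Cor22.CondP2 P l → Cor22.CondP5 P l → Cor22.CondP6 P l →
      ∀ T : Cor22.ThetaVolumeDatumAt P l, ((St T).col (Pc T).n).KummerB ((St T).D (Pc T).n))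
    (hPin : ∀ P : NFPoint, P ∈ UP → ∀ l : ℕ, l.Prime → 5 ≤ l →
      Cor22.AdmitsCore P → Cor22.CondP2 P l → Cor22.CondP5 P l → Cor22.CondP6 P l →
      ∀ T : Cor22.ThetaVolumeDatumAt P l, PinnedRegions3 (St T) (Pc T) (ρ T) (qK T))
    (hS : ∀ P : NFPoint, P ∈ UP → ∀ l : ℕ, l.Prime → 5 ≤ l →
      Cor22.AdmitsCore P → Cor22.CondP2 P l → Cor22.CondP5 P l → Cor22.CondP6 P l →
      ∀ T : Cor22.ThetaVolumeDatumAt P l, PilotKummerIndRelated (St T) (Pc T) (ρ T) (qK T))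
    (hΘle : ∀ P : NFPoint, P ∈ UP → ∀ l : ℕ, l.Prime → 5 ≤ l →
      Cor22.AdmitsCore P → Cor22.CondP2 P l → Cor22.CondP5 P l → Cor22.CondP6 P l →
      ∀ (T : Cor22.ThetaVolumeDatumAt P l) (x : ℝ), (Pc T).negLogTheta = (x : WithTop ℝ) → x ≤ T.negLogTheta)
    (hvol : ∀ P : NFPoint, P ∈ UP → ∀ l : ℕ, l.Prime → 5 ≤ l →
      Cor22.AdmitsCore P → Cor22.CondP2 P l → Cor22.CondP5 P l → Cor22.CondP6 P l →
        Cor22.HullVolumeAtDatum P l (((l : ℝ) + 1) / 4 *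
          ((1 + 12 * (Cor22.dmod P : ℝ) / l) * (P.logDiff + Cor22.logCondAvoid P {2, l})
            + 2 * Real.log l + 52
            + 20 / 3 * Real.log (((2 ^ 12 * 3 ^ 3 * 5 * Cor22.dmod P : ℕ) : ℝ) * (l : ℝ))
              * (Nat.primeCounting (2 ^ 12 * 3 ^ 3 * 5 * Cor22.dmod P * l) : ℝ)))) :
    Cor22.Thm110Legendre :=
  ThetaPartIIDisplay.thm110Legendre_of_squeezeIII fun P hP l hl h5 hcore h2 hP5 h6 => by
    obtain ⟨T⟩ := ThetaPartII.stub_thetaData P hP l hl h5 hcore h2 hP5 h6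
    exact Summit.ABC.IUTFork.PointDict.logQAvoid_le_of_cor312AtDatum
      (cor312AtDatum_of_pilotKummerIndRelated_fin (fun T => TI T) (fun T => St T) (fun T => Pc T) (fun T => ρ T)
        (fun T => qK T) (hSet P hP l hl h5 hcore h2 hP5 h6) (hBridge P hP l hl h5 hcore h2 hP5 h6)
        (hKumB P hP l hl h5 hcore h2 hP5 h6) (hPin P hP l hl h5 hcore h2 hP5 h6) (hS P hP l hl h5 hcore h2 hP5 h6)
        (hΘle P hP l hl h5 hcore h2 hP5 h6))
      (hvol P hP l hl h5 hcore h2 hP5 h6) T hP.1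

end Summit.ABC.ABC.Theorems.ThetaPartII

end
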